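import Summits.Ventures.LatticeQCDFlow.Exactness.IMHCoupledEstimatorHoeffding
import HarnessLib

/-!
# A certified finite-sample error bar for CLIPPED self-normalised reweighting, for every weight: the flow's other estimator,
# `θ̂ = Σ min(w̃_i, L) f(y_i) / Σ min(w̃_i, L)`, obeys `P(|θ̂ − π f| ≥ (t + m·s)/(B − s) + (c − a)·D/Z) ≤ 2e^{−Nt²/(2L²m²)} + 2e^{−2Ns²/L²}`

HONEST FRAMING: exact (Metropolis-corrected) sampling algorithms for lattice gauge theory;
figures of merit are autocorrelation/cost numbers at stated couplings and volumes; no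
continuum-physics claim.

Venture `LatticeQCDFlow` (cell pub-lqcd), topic `Exactness`; FANOUT row 30 (lean-1, GEN-41).  NEW WORK of the cell, general measurable
state space.  Besides the exact (Metropolis-corrected) chain, the flow literature estimates `π f` by SELF-NORMALISED REWEIGHTING of
i.i.d. proposals, `Σ w̃_i f(y_i)/Σ w̃_i` — strongly consistent for every model (`Exactness/RatioEstimator.lean`) but with no finite-sample
guarantee when the weight is unbounded (the summands are unbounded).  CLIPPING the unnormalised weight at a declared level `L`,
`v = min(w̃, L)`, makes both sums averages of BOUNDED variables and moves the model error into an explicit, one-signed bias — the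
analogue for reweighting of GEN-40's every-weight bars for the chain.  Setting: proposal law `q` (probability), unnormalised weight
`w̃ ≥ 0` measurable with `Z = E_q[w̃] > 0`, observable `a ≤ f ≤ c` measurable, `m = max(|a|, |c|)`; population clipped moments
`A = E_q[v·f]`, `B = E_q[v] > 0`, clipped target value `θ_L = A/B`, clipping defect `D = E_q[w̃ − v] = E_q[(w̃ − L)⁺]`.

* §1 (deterministic) `clip_mem_Icc`, `clip_mul_mem_Icc` (`v ∈ [0, L]`, `v·f ∈ [−Lm, Lm]`); `clippedMean_mem_Icc` (`θ_L ∈ [a, c]`);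
  **`clippedMean_sub_target_eq`** — THE BIAS IDENTITY `θ_L − π f = E_q[(w̃ − v)(θ_L − f)]/Z`; **`clippedMean_sub_target_abs_le`** —
  `|θ_L − π f| ≤ (c − a)·D/Z`; `clipDefect_le_setIntegral` — `D ≤ ∫_{w̃ > L} w̃ dq = Z·π{w̃ > L}`;
  **`ratio_sub_ratio_abs_le`** — `|Â/B̂ − A/B| ≤ (|Â − A| + |A/B|·|B̂ − B|)/B̂` for `B̂ > 0`.
* §2 (i.i.d. proposals `y_0, y_1, …` with law `q` on a probability space) **`clippedReweighting_abs_sub_clippedMean_ge_le`** — for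
  `N ≥ 1`, `t ≥ 0`, `0 < s < B`: `P(|θ̂_N − θ_L| ≥ (t + m·s)/(B − s)) ≤ 2·exp(−Nt²/(2L²m²)) + 2·exp(−2Ns²/L²)` (two Hoeffding bars and the
  ratio lemma); **`clippedReweighting_abs_sub_target_ge_le`** — about `π f`:
  `P(|θ̂_N − π f| ≥ (t + m·s)/(B − s) + (c − a)·D/Z) ≤ 2·exp(−Nt²/(2L²m²)) + 2·exp(−2Ns²/L²)`.
* §3 `target_integral_eq_unnormalised_div` — `π f = E_q[w̃ f]/Z` (the normalised reading of §2).
Reading: the inputs are `B = E_q[min(w̃, L)]` (a bounded proposal mean, itself Hoeffding-certifiable from the same stream — and a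
lower bound on `Z`) and the clipping bias `D/Z ≤ π{w̃ > L}` (a TARGET tail: certifiable from exact target samples, or from an upper
bound on `Z` as in `IMHCertificateCalibration`; NOT from proposals — `HiddenSectorNoCertificate`).  Unclipped reweighting (`L = ∞`)
has `D = 0` and no finite-sample bar; the exact chain needs no clipping but pays the coupling term.  NOT CLAIMED: the optimal `L`;
a variance-sensitive (Bernstein) form; anything for unbounded `f`.  No `sorry`, no new definitions, nothing cited as a fact.
-/

noncomputable section

namespace Summit.Ventures.LatticeQCDFlow.Exactness

open MeasureTheory ProbabilityTheory Function Finset Filter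
open scoped ENNReal

variable {Ω : Type*} [MeasurableSpace Ω] {q : Measure Ω} {wt f : Ω → ℝ} {L a c : ℝ}

/-! ## §1 Deterministic: clipping, the bias identity, the ratio lemma -/

omit [MeasurableSpace Ω] in
/-- `v = min(w̃, L) ∈ [0, L]` for `w̃ ≥ 0`, `L ≥ 0`. [ours, bookkeeping] -/
theorem clip_mem_Icc (hwt0 : ∀ y, 0 ≤ wt y) (hL : 0 ≤ L) (y : Ω) : min (wt y) L ∈ Set.Icc 0 L :=
  ⟨le_min (hwt0 y) hL, min_le_right _ _⟩

omit [MeasurableSpace Ω] in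
/-- `v·f ∈ [−L·m, L·m]` with `m = max(|a|, |c|)` for `a ≤ f ≤ c`. [ours, bookkeeping] -/
theorem clip_mul_mem_Icc (hwt0 : ∀ y, 0 ≤ wt y) (hL : 0 ≤ L) (ha : ∀ y, a ≤ f y) (hc : ∀ y, f y ≤ c) (y : Ω) :
    min (wt y) L * f y ∈ Set.Icc (-(L * max |a| |c|)) (L * max |a| |c|) := by
  have hv := clip_mem_Icc hwt0 hL y
  have hf : |f y| ≤ max |a| |c| := abs_le_max_abs_abs (ha y) (hc y)
  have h : |min (wt y) L * f y| ≤ L * max |a| |c| := by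
    rw [abs_mul, abs_of_nonneg hv.1]
    exact mul_le_mul hv.2 hf (abs_nonneg _) hL
  exact ⟨(abs_le.1 h).1, (abs_le.1 h).2⟩

/-- **The clipped target value is a mean of `f`**: `a·B ≤ A ≤ c·B`, hence `θ_L = A/B ∈ [a, c]` when `B > 0` (`v ≥ 0`; `v`, `v·f`
integrable). [ours] -/
theorem clippedMean_mem_Icc (hwt0 : ∀ y, 0 ≤ wt y) (hL : 0 ≤ L) (ha : ∀ y, a ≤ f y) (hc : ∀ y, f y ≤ c)
    (hvi : Integrable (fun y => min (wt y) L) q) (hvfi : Integrable (fun y => min (wt y) L * f y) q)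
    (hB : 0 < ∫ y, min (wt y) L ∂q) :
    (∫ y, min (wt y) L * f y ∂q) / (∫ y, min (wt y) L ∂q) ∈ Set.Icc a c := by
  have hv0 : ∀ y, 0 ≤ min (wt y) L := fun y => (clip_mem_Icc hwt0 hL y).1
  constructor
  · rw [le_div_iff₀ hB, ← integral_const_mul]
    exact integral_mono (hvi.const_mul a) hvfi fun y => by
      simpa [mul_comm] using mul_le_mul_of_nonneg_left (ha y) (hv0 y)
  · rw [div_le_iff₀ hB, ← integral_const_mul]
    exact integral_mono hvfi (hvi.const_mul c) fun y => by
      simpa [mul_comm] using mul_le_mul_of_nonneg_left (hc y) (hv0 y)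

/-- **THE BIAS IDENTITY**: `θ_L − π f = E_q[(w̃ − v)(θ_L − f)]/Z` with `π f = E_q[w̃ f]/Z`, `Z = E_q[w̃] ≠ 0`, `B = E_q[v] ≠ 0`
(`w̃`, `w̃ f`, `v`, `v f` integrable). [ours] -/
theorem clippedMean_sub_target_eq (hwi : Integrable wt q) (hwfi : Integrable (fun y => wt y * f y) q)
    (hvi : Integrable (fun y => min (wt y) L) q) (hvfi : Integrable (fun y => min (wt y) L * f y) q)
    (hZ : ∫ y, wt y ∂q ≠ 0) (hB : ∫ y, min (wt y) L ∂q ≠ 0) :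
    (∫ y, min (wt y) L * f y ∂q) / (∫ y, min (wt y) L ∂q) - (∫ y, wt y * f y ∂q) / (∫ y, wt y ∂q) =
      (∫ y, (wt y - min (wt y) L) * ((∫ z, min (wt z) L * f z ∂q) / (∫ z, min (wt z) L ∂q) - f y) ∂q) / ∫ y, wt y ∂q := by
  set A := ∫ y, min (wt y) L * f y ∂q with hA
  set B := ∫ y, min (wt y) L ∂q with hBdef
  set Z := ∫ y, wt y ∂q with hZdef
  set F := ∫ y, wt y * f y ∂q with hF
  have hexp : ∫ y, (wt y - min (wt y) L) * (A / B - f y) ∂q = A / B * (Z - B) - (F - A) := by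
    have hlin : (fun y => (wt y - min (wt y) L) * (A / B - f y)) =
        fun y => A / B * (wt y - min (wt y) L) - (wt y * f y - min (wt y) L * f y) := funext fun y => by ring
    rw [hlin, integral_sub ((hwi.sub' hvi).const_mul (A / B)) (hwfi.sub' hvfi), integral_const_mul, integral_sub hwi hvi,
      integral_sub hwfi hvfi]
  rw [hexp]
  field_simp
  ring

/-- **`|θ_L − π f| ≤ (c − a)·D/Z`**, `D = E_q[w̃ − v] ≥ 0` (`Z > 0`, `B > 0`, `a ≤ f ≤ c`). [ours] -/
theorem clippedMean_sub_target_abs_le (hwt0 : ∀ y, 0 ≤ wt y) (hL : 0 ≤ L) (ha : ∀ y, a ≤ f y) (hc : ∀ y, f y ≤ c)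
    (hwi : Integrable wt q) (hwfi : Integrable (fun y => wt y * f y) q)
    (hvi : Integrable (fun y => min (wt y) L) q) (hvfi : Integrable (fun y => min (wt y) L * f y) q)
    (hZ : 0 < ∫ y, wt y ∂q) (hB : 0 < ∫ y, min (wt y) L ∂q) :
    |(∫ y, min (wt y) L * f y ∂q) / (∫ y, min (wt y) L ∂q) - (∫ y, wt y * f y ∂q) / (∫ y, wt y ∂q)| ≤
      (c - a) * (∫ y, (wt y - min (wt y) L) ∂q) / ∫ y, wt y ∂q := by
  set θ := (∫ y, min (wt y) L * f y ∂q) / (∫ y, min (wt y) L ∂q) with hθ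
  have hθmem : θ ∈ Set.Icc a c := clippedMean_mem_Icc hwt0 hL ha hc hvi hvfi hB
  rw [clippedMean_sub_target_eq hwi hwfi hvi hvfi hZ.ne' hB.ne', abs_div, abs_of_pos hZ, div_le_div_iff_of_pos_right hZ]
  have hpt : ∀ y, |(wt y - min (wt y) L) * (θ - f y)| ≤ (c - a) * (wt y - min (wt y) L) := by
    intro y
    have hd : 0 ≤ wt y - min (wt y) L := sub_nonneg.2 (min_le_left _ _)
    rw [abs_mul, abs_of_nonneg hd, mul_comm]
    refine mul_le_mul_of_nonneg_right (abs_sub_le_iff.2 ⟨by linarith [ha y, hθmem.2], by linarith [hc y, hθmem.1]⟩) hd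
  calc |∫ y, (wt y - min (wt y) L) * (θ - f y) ∂q| ≤ ∫ y, |(wt y - min (wt y) L) * (θ - f y)| ∂q := abs_integral_le_integral_abs
    _ ≤ ∫ y, (c - a) * (wt y - min (wt y) L) ∂q := by
        refine integral_mono_of_nonneg (ae_of_all _ fun y => abs_nonneg _) ((hwi.sub hvi).const_mul _) (ae_of_all _ hpt)
    _ = (c - a) * ∫ y, (wt y - min (wt y) L) ∂q := integral_const_mul _ _

/-- **The clipping defect is a target tail**: `D = E_q[w̃ − min(w̃, L)] ≤ ∫_{L < w̃} w̃ dq` (`= Z·π{w̃ > L}`; `w̃ ≥ 0`, `L ≥ 0`). [ours] -/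
theorem clipDefect_le_setIntegral (hwt : Measurable wt) (hwt0 : ∀ y, 0 ≤ wt y) (hwi : Integrable wt q) (hL : 0 ≤ L) :
    ∫ y, (wt y - min (wt y) L) ∂q ≤ ∫ y in {y | L < wt y}, wt y ∂q := by
  rw [← integral_indicator (measurableSet_lt measurable_const hwt)]
  refine integral_mono_of_nonneg (ae_of_all _ fun y => sub_nonneg.2 (min_le_left _ _))
    (hwi.indicator (measurableSet_lt measurable_const hwt)) (ae_of_all _ fun y => ?_)
  show wt y - min (wt y) L ≤ Set.indicator {y | L < wt y} wt y
  by_cases hy : L < wt y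
  · rw [Set.indicator_of_mem (show y ∈ {y | L < wt y} from hy)]
    linarith [le_min (hwt0 y) hL]
  · rw [Set.indicator_of_notMem (show y ∉ {y | L < wt y} from hy), min_eq_left (not_lt.1 hy), sub_self]

/-- **THE RATIO LEMMA**: `|Â/B̂ − A/B| ≤ (|Â − A| + |A/B|·|B̂ − B|)/B̂` for `B̂ > 0`, `B ≠ 0`. [ours, bookkeeping] -/
theorem ratio_sub_ratio_abs_le {Ah Bh A B : ℝ} (hBh : 0 < Bh) (hB : B ≠ 0) :
    |Ah / Bh - A / B| ≤ (|Ah - A| + |A / B| * |Bh - B|) / Bh := by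
  have hid : Ah / Bh - A / B = ((Ah - A) + A / B * (B - Bh)) / Bh := by field_simp; ring
  rw [hid, abs_div, abs_of_pos hBh, div_le_div_iff_of_pos_right hBh]
  calc |Ah - A + A / B * (B - Bh)| ≤ |Ah - A| + |A / B * (B - Bh)| := abs_add_le _ _
    _ = |Ah - A| + |A / B| * |Bh - B| := by rw [abs_mul, abs_sub_comm B Bh]

/-! ## §2 The certificate from i.i.d. proposals -/

section IID

variable {Ω' : Type*} {mΩ' : MeasurableSpace Ω'} {μ : Measure Ω'} [IsProbabilityMeasure μ] {Y : ℕ → Ω' → Ω}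

/-- **CLIPPED REWEIGHTING CONCENTRATES ABOUT THE CLIPPED TARGET VALUE**: `y_0, y_1, …` i.i.d. with law `q`; `w̃ ≥ 0`, `f ∈ [a, c]`
measurable; `L ≥ 0`, `m = max(|a|, |c|)`; for `N ≥ 1`, `t ≥ 0`, `0 < s < B = E_q[min(w̃, L)]`:
`P(|Σ_{i<N} v_i f_i / Σ_{i<N} v_i − θ_L| ≥ (t + m·s)/(B − s)) ≤ 2·exp(−2Nt²/(2Lm)²) + 2·exp(−2Ns²/L²)`. [ours] -/
theorem clippedReweighting_abs_sub_clippedMean_ge_le [IsProbabilityMeasure q] (hwt : Measurable wt) (hwt0 : ∀ y, 0 ≤ wt y)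
    (hf : Measurable f) (ha : ∀ y, a ≤ f y) (hc : ∀ y, f y ≤ c) (hL : 0 ≤ L) (hYm : ∀ j, Measurable (Y j))
    (hlaw : ∀ j, μ.map (Y j) = q) (hind : iIndepFun Y μ) {N : ℕ} (hN : 1 ≤ N) {t s : ℝ} (ht : 0 ≤ t) (hs : 0 < s)
    (hsB : s < ∫ y, min (wt y) L ∂q) :
    μ.real {ω | (t + max |a| |c| * s) / ((∫ y, min (wt y) L ∂q) - s) ≤
        |(∑ j ∈ range N, min (wt (Y j ω)) L * f (Y j ω)) / (∑ j ∈ range N, min (wt (Y j ω)) L) -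
          (∫ y, min (wt y) L * f y ∂q) / (∫ y, min (wt y) L ∂q)|} ≤
      2 * Real.exp (-(2 * N * t ^ 2) / (L * max |a| |c| - -(L * max |a| |c|)) ^ 2) + 2 * Real.exp (-(2 * N * s ^ 2) / (L - 0) ^ 2) := by
  set m := max |a| |c| with hm
  set A := ∫ y, min (wt y) L * f y ∂q with hA
  set B := ∫ y, min (wt y) L ∂q with hBdef
  have hB : 0 < B := hs.trans hsB
  have hvm : Measurable fun y => min (wt y) L := hwt.min measurable_const
  have hvfm : Measurable fun y => min (wt y) L * f y := hvm.mul hf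
  have hvi : Integrable (fun y => min (wt y) L) q :=
    Integrable.of_bound hvm.aestronglyMeasurable L (ae_of_all _ fun y => by
      rw [Real.norm_eq_abs, abs_of_nonneg (clip_mem_Icc hwt0 hL y).1]; exact (clip_mem_Icc hwt0 hL y).2)
  have hvfi : Integrable (fun y => min (wt y) L * f y) q :=
    Integrable.of_bound hvfm.aestronglyMeasurable (L * m) (ae_of_all _ fun y => by
      rw [Real.norm_eq_abs]; exact abs_le.2 (clip_mul_mem_Icc hwt0 hL ha hc y))
  have hθ : A / B ∈ Set.Icc a c := clippedMean_mem_Icc hwt0 hL ha hc hvi hvfi hB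
  have hθm : |A / B| ≤ m := abs_le_max_abs_abs hθ.1 hθ.2
  -- the two Hoeffding bars
  have hXm : ∀ j, Measurable fun ω => min (wt (Y j ω)) L * f (Y j ω) := fun j => hvfm.comp (hYm j)
  have hVm : ∀ j, Measurable fun ω => min (wt (Y j ω)) L := fun j => hvm.comp (hYm j)
  have hXind : iIndepFun (fun j ω => min (wt (Y j ω)) L * f (Y j ω)) μ := hind.comp (fun _ => _) fun _ => hvfm
  have hVind : iIndepFun (fun j ω => min (wt (Y j ω)) L) μ := hind.comp (fun _ => _) fun _ => hvm
  have hXmean : ∀ j, μ[fun ω => min (wt (Y j ω)) L * f (Y j ω)] = A := fun j => by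
    rw [hA, ← hlaw j, integral_map (hYm j).aemeasurable hvfm.aestronglyMeasurable]
  have hVmean : ∀ j, μ[fun ω => min (wt (Y j ω)) L] = B := fun j => by
    rw [hBdef, ← hlaw j, integral_map (hYm j).aemeasurable hvm.aestronglyMeasurable]
  have h1 := hoeffding_avg_abs_of_mem_Icc (μ := μ) (X := fun j ω => min (wt (Y j ω)) L * f (Y j ω)) hXm hXind
    (a := -(L * m)) (b := L * m) (fun j ω => clip_mul_mem_Icc hwt0 hL ha hc (Y j ω)) hXmean ht hN
  have h2 := hoeffding_avg_abs_of_mem_Icc (μ := μ) (X := fun j ω => min (wt (Y j ω)) L) hVm hVind (a := 0) (b := L)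
    (fun j ω => clip_mem_Icc hwt0 hL (Y j ω)) hVmean hs.le hN
  -- off both bad events the ratio is close
  have hNpos : (0 : ℝ) < N := Nat.cast_pos.2 (by omega)
  have hsub : {ω | (t + m * s) / (B - s) ≤ |(∑ j ∈ range N, min (wt (Y j ω)) L * f (Y j ω)) / (∑ j ∈ range N, min (wt (Y j ω)) L) - A / B|}
      ⊆ {ω | t ≤ |(N : ℝ)⁻¹ * ∑ j ∈ range N, min (wt (Y j ω)) L * f (Y j ω) - A|} ∪
        {ω | s ≤ |(N : ℝ)⁻¹ * ∑ j ∈ range N, min (wt (Y j ω)) L - B|} := by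
    intro ω hω
    simp only [Set.mem_setOf_eq, Set.mem_union] at hω ⊢
    by_contra hcon
    push Not at hcon
    obtain ⟨hA', hB'⟩ := hcon
    set Ah := (N : ℝ)⁻¹ * ∑ j ∈ range N, min (wt (Y j ω)) L * f (Y j ω) with hAh
    set Bh := (N : ℝ)⁻¹ * ∑ j ∈ range N, min (wt (Y j ω)) L with hBh
    have hBh_pos : B - s < Bh := by have := abs_lt.1 hB'; linarith
    have hBs : 0 < B - s := by linarith
    have hBhpos : 0 < Bh := hBs.trans hBh_pos
    -- the ratio of the sums is the ratio of the averages
    have hratio : (∑ j ∈ range N, min (wt (Y j ω)) L * f (Y j ω)) / (∑ j ∈ range N, min (wt (Y j ω)) L) = Ah / Bh := by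
      rw [hAh, hBh, mul_div_mul_left _ _ (inv_ne_zero hNpos.ne')]
    rw [hratio] at hω
    have hr := ratio_sub_ratio_abs_le (Ah := Ah) (A := A) hBhpos hB.ne'
    have hnum : |Ah - A| + |A / B| * |Bh - B| < t + m * s := by
      have := mul_le_mul hθm (abs_lt.2 ⟨by linarith [(abs_lt.1 hB').1], (abs_lt.1 hB').2⟩).le (abs_nonneg _) (le_trans (abs_nonneg _) hθm)
      have hA'' : |Ah - A| < t := hA'
      nlinarith [abs_nonneg (Bh - B), abs_nonneg (A / B)]
    have hlt : |Ah / Bh - A / B| < (t + m * s) / (B - s) := by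
      calc |Ah / Bh - A / B| ≤ (|Ah - A| + |A / B| * |Bh - B|) / Bh := hr
        _ ≤ (|Ah - A| + |A / B| * |Bh - B|) / (B - s) :=
            div_le_div_of_nonneg_left (by positivity) hBs hBh_pos.le
        _ < (t + m * s) / (B - s) := div_lt_div_of_pos_right hnum hBs
    linarith
  calc μ.real {ω | (t + m * s) / (B - s) ≤ |(∑ j ∈ range N, min (wt (Y j ω)) L * f (Y j ω)) / (∑ j ∈ range N, min (wt (Y j ω)) L) - A / B|}
      ≤ μ.real ({ω | t ≤ |(N : ℝ)⁻¹ * ∑ j ∈ range N, min (wt (Y j ω)) L * f (Y j ω) - A|} ∪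
          {ω | s ≤ |(N : ℝ)⁻¹ * ∑ j ∈ range N, min (wt (Y j ω)) L - B|}) := measureReal_mono hsub
    _ ≤ μ.real {ω | t ≤ |(N : ℝ)⁻¹ * ∑ j ∈ range N, min (wt (Y j ω)) L * f (Y j ω) - A|} +
          μ.real {ω | s ≤ |(N : ℝ)⁻¹ * ∑ j ∈ range N, min (wt (Y j ω)) L - B|} := measureReal_union_le _ _
    _ ≤ 2 * Real.exp (-(2 * N * t ^ 2) / (L * m - -(L * m)) ^ 2) + 2 * Real.exp (-(2 * N * s ^ 2) / (L - 0) ^ 2) := add_le_add h1 h2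

/-- **THE CLIPPED-REWEIGHTING CERTIFICATE ABOUT `π f`** (`π f = E_q[w̃ f]/Z`, `Z = E_q[w̃] > 0`): with `D = E_q[w̃ − min(w̃, L)]`,
`P(|Σ v_i f_i/Σ v_i − π f| ≥ (t + m·s)/(B − s) + (c − a)·D/Z) ≤ 2·exp(−2Nt²/(2Lm)²) + 2·exp(−2Ns²/L²)`. [ours] -/
theorem clippedReweighting_abs_sub_target_ge_le [IsProbabilityMeasure q] (hwt : Measurable wt) (hwt0 : ∀ y, 0 ≤ wt y)
    (hwi : Integrable wt q) (hZ : 0 < ∫ y, wt y ∂q) (hf : Measurable f) (ha : ∀ y, a ≤ f y) (hc : ∀ y, f y ≤ c) (hL : 0 ≤ L)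
    (hYm : ∀ j, Measurable (Y j)) (hlaw : ∀ j, μ.map (Y j) = q) (hind : iIndepFun Y μ) {N : ℕ} (hN : 1 ≤ N) {t s : ℝ}
    (ht : 0 ≤ t) (hs : 0 < s) (hsB : s < ∫ y, min (wt y) L ∂q) :
    μ.real {ω | (t + max |a| |c| * s) / ((∫ y, min (wt y) L ∂q) - s) +
          (c - a) * (∫ y, (wt y - min (wt y) L) ∂q) / (∫ y, wt y ∂q) ≤
        |(∑ j ∈ range N, min (wt (Y j ω)) L * f (Y j ω)) / (∑ j ∈ range N, min (wt (Y j ω)) L) -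
          (∫ y, wt y * f y ∂q) / (∫ y, wt y ∂q)|} ≤
      2 * Real.exp (-(2 * N * t ^ 2) / (L * max |a| |c| - -(L * max |a| |c|)) ^ 2) + 2 * Real.exp (-(2 * N * s ^ 2) / (L - 0) ^ 2) := by
  set m := max |a| |c| with hm
  set A := ∫ y, min (wt y) L * f y ∂q with hA
  set B := ∫ y, min (wt y) L ∂q with hBdef
  set θπ := (∫ y, wt y * f y ∂q) / (∫ y, wt y ∂q) with hθπ
  have hB : 0 < B := hs.trans hsB
  have hvm : Measurable fun y => min (wt y) L := hwt.min measurable_const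
  have hvi : Integrable (fun y => min (wt y) L) q :=
    Integrable.of_bound hvm.aestronglyMeasurable L (ae_of_all _ fun y => by
      rw [Real.norm_eq_abs, abs_of_nonneg (clip_mem_Icc hwt0 hL y).1]; exact (clip_mem_Icc hwt0 hL y).2)
  have hvfi : Integrable (fun y => min (wt y) L * f y) q :=
    Integrable.of_bound (hvm.mul hf).aestronglyMeasurable (L * m) (ae_of_all _ fun y => by
      rw [Real.norm_eq_abs]; exact abs_le.2 (clip_mul_mem_Icc hwt0 hL ha hc y))
  have hfC : ∀ y, |f y| ≤ m := fun y => abs_le_max_abs_abs (ha y) (hc y)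
  have hwfi : Integrable (fun y => wt y * f y) q := by
    refine Integrable.mono' (hwi.norm.mul_const m) (hwt.mul hf).aestronglyMeasurable (ae_of_all _ fun y => ?_)
    rw [Real.norm_eq_abs, abs_mul, Real.norm_eq_abs]
    exact mul_le_mul_of_nonneg_left (hfC y) (abs_nonneg _)
  have hbias := clippedMean_sub_target_abs_le hwt0 hL ha hc hwi hwfi hvi hvfi hZ hB
  have h := clippedReweighting_abs_sub_clippedMean_ge_le (μ := μ) hwt hwt0 hf ha hc hL hYm hlaw hind hN ht hs hsB
  refine (measureReal_mono fun ω hω => ?_).trans h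
  simp only [Set.mem_setOf_eq] at hω ⊢
  have htri : |(∑ j ∈ range N, min (wt (Y j ω)) L * f (Y j ω)) / (∑ j ∈ range N, min (wt (Y j ω)) L) - θπ| ≤
      |(∑ j ∈ range N, min (wt (Y j ω)) L * f (Y j ω)) / (∑ j ∈ range N, min (wt (Y j ω)) L) - A / B| + |A / B - θπ| :=
    abs_sub_le _ _ _
  have hb' : |A / B - θπ| ≤ (c - a) * (∫ y, (wt y - min (wt y) L) ∂q) / ∫ y, wt y ∂q := hbias
  linarith

end IID

/-! ## §3 The normalised reading -/

/-- `π f = E_q[w̃ f]/Z` for `π = w·q` with `w = w̃/Z` measurable, `Z ≠ 0` (the target value in §2's statements). [ours, bookkeeping] -/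
theorem target_integral_eq_unnormalised_div {w : Ω → ℝ} (hw : Measurable w) (hw0 : ∀ y, 0 ≤ w y) {Znorm : ℝ}
    (hwZ : ∀ y, w y = wt y / Znorm) (f : Ω → ℝ) :
    ∫ y, f y ∂(q.withDensity fun y => ENNReal.ofReal (w y)) = (∫ y, wt y * f y ∂q) / Znorm := by
  rw [integral_withDensity_eq_integral_toReal_smul hw.ennreal_ofReal (ae_of_all _ fun x => ENNReal.ofReal_lt_top)]
  rw [div_eq_mul_inv, ← integral_mul_const]
  refine integral_congr_ae (ae_of_all _ fun y => ?_)
  simp only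
  rw [ENNReal.toReal_ofReal (hw0 y), smul_eq_mul, hwZ y]
  ring

end Summit.Ventures.LatticeQCDFlow.Exactness
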